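/-
Copyright: the b2b-balaban T⁴-continuum CRUX team, row NE7b leaf lineage `t4-ne7b-formalise-leaf-06` (gen 158). Project licence.
-/
import Summits.QuantumFields.BalabanUV.T4Continuum.Spine.NE7b.OneShotChartFourier
import Literature.MathematicalPhysics.QuantumFieldTheory.Balaban1983to89.B4TorusKernel

/-!
# THE ONE-SHOT SECTION's MULTIPLIER IS STRIP-REGULAR, UNIFORMLY IN THE MESH: `P ↦ G_{N,a,0,τ}(P) ∕ (Q′G′Q′*)~(P)` is
# `StripRegular κ C` with `κ > 0`, `C` depending on `d, a` only — hence the MESH-FREE pointwise exponential decay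
# `|H(chart n x τ, y)| ≤ C·e^{−κ|x−y|_∞}` of the scalar `H = G′Q′*(Q′G′Q′*)⁻¹` on `ℤ^{d+1}` for EVERY `d`, with explicit
# (crude) constants, and the decay of its periodisation on every torus (row NE7b, node U5c; Fourier analyticity =
# the contour shift of the tree's `B4ContourShift`, assembled BY NAME over the B4∕B5∕B6 strip columns; [folklore])

Cell `pub-balaban`, sub-cell `t4`, spine estimate NE7b (`T4WeightBudget.RelWeightBound`; the cell's OWN estimate — NOT PRINTED in
[Bałaban 1983–89], NOT PROVED).  Crux-route work under `Spine/NE7b/` by leaf-06 (CRUX team (2), FREEZE (0) crux-prover clause).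
NOTHING of Bałaban's is named as a Lean object, valued or asserted; no `T4Continuum/Support` leaf typed; no `def`; zero `sorry`.

WHY.  The pricing desk's located letter-gap NL-NE7b-1 (PRICING-NE7b v121 F721) is the chart constant of the one-shot section in the
SUP currency that `…HardStepRadiusSupNorm` consumes; idea-1 g109's T-109 (`t4/ideate/NE7b/checks-g109/T109-…md` §4–§5) names the
device print NAMES for it (CMP 95 p. 36) and does not use — Combes–Thomas ∕ Paley–Wiener in the block-momentum fibre — whose first
piece is (CT-1): «the fibre symbol is zero-free with two-sided bounds on a complex strip, UNIFORMLY in the block side».  The OWNER's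
(41) `…OneShotChartFourier.kerH_chart_eq_latticeKernel` identifies the block rows of `H` with the lattice kernel of the zone multiplier
`G_{N,a,0,τ} ∕ symbQGQ_{N,a}` (`N = n + 1`); the tree's B4 strip column (`B4StripSums.stripRegular_G`, `B4StripCauchy`'s j-uniform zero-free
strip of `E`, `B5Strip145Analytic`'s joint holomorphy and side periodicity) was built for the multiplier of `G′Q′*` and of (1.45).  THIS FILE
runs the same engine on the one-shot multiplier: the only new analytic input is a lower bound for `aX = E − Δ^ξ` (`X = Σ_k U_kR_k ≥ (4∕π²)^d`
on the real zone, `B6QGQFourier275Zd.Xr_ge`) on a thin strip, by the imaginary-direction Lipschitz bounds of `E` (the tree's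
`uniformImLipschitz_holds`) and of `Δ^ξ` (Cauchy's estimate `imLipschitz_of_fat`), and the side periodicity of `symbQGQ = (B − 1)∕(aB)`
(`B = B5Strip145Analytic.Bfac`, periodic by `Bfac_tr`).  The OWNER's (46) `…OneShotChartSupNorm` (filed 23:27Z 2026-08-24) gives the
`ℓ^∞ → ℓ^∞` letter on `ℤ^d`, `d ≥ 3`, from the β-team's elliptic-regularity bound `D1BFx/BlockColumnSupNorm.abs_kerH_le_sup` with a constant
existential in `d`; the present route is independent (Fourier analyticity), covers EVERY `d + 1 ≥ 1`, has constants that are explicit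
closed forms of the tree's `rOf ∕ boundM ∕ LambdaOf ∕ boundG` (crude), and descends to tori by `B4TorusKernel`.

WHAT IS PROVED (`N ≥ 1` the block side, `a > 0`; `Strip`, `Fat`, `E`, `DeltaXi`, `U`, `R`, `G` the B4 strip column's objects; `symbQGQ` of
`B6QGQFourier275Zd`; `kerH` of `B5Hk103ScalarZd`; all [folklore]):
* §1 `norm_DeltaXi_sub_re_le` (imaginary-direction Lipschitz bound of `Δ^ξ` on `Strip d κ`, `κ ≤ r(d)`: constant `16d∕r(d)`).
* §2 `norm_E_sub_DeltaXi_ge` (`a(4∕π²)^d∕2 ≤ ‖E − Δ^ξ‖` on a thin strip — the numerator `aX` of `1∕symbQGQ = E∕X` is zero-free).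
* §3 `symbQGQ_eq_div` (`symbQGQ = (E − Δ^ξ)∕(aE)`), `symbQGQ_eq_Bfac` (`= (B − 1)∕(aB)` where `Δ^ξ ≠ 0`), `symbQGQ_periodic_side`
  (`2π`-periodicity across the strip sides), `differentiableAt_symbQGQ` (joint holomorphy on the fat region where `E ≠ 0`),
  `norm_symbQGQ_ge` (`(4∕π²)^d∕(2M_E) ≤ ‖symbQGQ‖` on the thin strip).
* §4 **`stripRegular_symbQGQ_inv`**, **`stripRegular_oneShot_of`** (given the two strip lower bounds: the one-shot multiplier
  `P ↦ G_{N,a,0,τ}(P) ∕ symbQGQ_{N,a}(P)` is `StripRegular κ (boundG·(2M_E)∕(4∕π²)^{d+1})` for EVERY `N`, `τ`), and the assembly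
  **`exists_stripRegular_oneShot`**: `∃ κ > 0, ∃ C > 0` (depending on `d, a` only), `∀ n τ`, `StripRegular (G_{n+1,a,0,τ}∕symbQGQ_{n+1,a}) κ C`.
* §5 **`exists_kerH_decay_chart`** ∕ **`exists_kerH_decay`**: `∃ κ > 0, ∃ C > 0, ∀ n x τ y, |kerH n a (chart n x τ) y| ≤ C·e^{−κ|x−y|_∞}`
  (resp. `∀ n z y`, with `|blk n z − y|_∞`) — the MESH-FREE ENTRY BOUND of the one-shot section on `ℤ^{d+1}`, every `d`.
* §6 **`torusKernel_oneShot_decay`**: the periodisation of the one-shot multiplier's kernel on EVERY torus `Π ℤ∕N_i` (all `N_i ≥ 1`) is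
  bounded by `C·periodConst κ d·e^{−(κ∕(d+1))|x|_{T,∞}}` (`B4TorusKernel.MultiPeriod.torusKernel_descend_decay_torusMetric` BY NAME).

HONEST BY VALUE.  The witnesses are the B4 strip column's crude rationals (`r(d) = 1∕(4(d+1))`, `M_E = boundM`, `Λ = LambdaOf`, `boundG`):
the strip half-width `κ` is tiny against T-109's by-value `q ≈ 0.9` per block and `C` is astronomical (the desk's F711 instrument no. 4
found `10^{366}` for the same family's `ℓ²` constant); so this file makes Road B's hypothesis (CT-1) NON-EMPTY uniformly in the mesh and
supplies NOTHING by value; (CT-2) Paley–Wiener, (CT-3) the certified near field, and the identification of §6's torus kernel with the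
torus one-shot SECTION (Fourier-inversion bookkeeping) are NOT HERE.  Nothing of (A3) ∕ NC-NE7b-α.  BY-NAME EFFECT ON THE WALL: NONE.
NE7b NOT PRINTED ∕ NOT PROVED; spine PROVED 0∕9; rung (B)+1 on a FINITE torus — NOT infinite volume, NOT the mass gap, NOT Clay.
HONEST DEPENDENCY: continuum YM on T⁴ ⇐ BetaPertH ∧ nine spine estimates (0∕9 proved); BetaPertH ⇐ (D1) ∧ (D4) ∧ CAP+tail; G-an2-4
gates asym, D1 and NE2∕3∕4.
-/

set_option autoImplicit false

namespace Summit.QuantumFields.BalabanUV.T4Continuum.NE7b.OneShotChartStrip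

open Complex Finset
open Literature.MathematicalPhysics.QuantumFieldTheory.Balaban1983to89
open B4Strip (Strip ofRealVec reVec shift E DeltaXi Ur Er DeltaXir shiftr ImLipschitz strip_lower_bound E_ofReal
  DeltaXi_ofReal Ur_zero_ge Ur_nonneg DeltaXir_nonneg)
open B4StripCauchy (Fat strip_subset_fat rOf rOf_pos rOf_le d_mul_rOf_sq_le imLipschitz_of_fat norm_E_le norm_DeltaXi_le
  boundM boundM_nonneg LambdaOf uniformImLipschitz_holds uniformStrip_explicit)
open B4StripSums (G R stripRegular_G boundG boundG_nonneg differentiableAt_R)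
open B4Green244 (E_eq_sum_R)
open B5Strip145Analytic (kappa_small strip_mono tr tr_im tr_re_self tr_apply_self Bfac Bfac_tr E_eq_DeltaXi_mul_Bfac re_DeltaXi_pos_of_edge
  differentiableAt_U differentiableAt_E differentiableAt_DeltaXi differentiableAt_update dAt_div)
open B5Strip145Decay (differentiableAt_insertNth tr_insertNth_left insertNth_left_mem)
open B4ContourShift (StripRegular stripRegular_inv latticeKernel latticeKernel_decay supNorm BZ openRect
  openRect_subset_closedRect insertNth_mem_Strip)
open B6QGQFourier275Zd (symbQGQ)
open B6QGQLower276 (X blk chart locFin chart_blk_locFin)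
open B5Hk103ScalarZd (kerH)
open OneShotChartFourier (kerH_chart_eq_latticeKernel)
open scoped Real

variable {d : ℕ}

/-! ## §1. The imaginary-direction Lipschitz bound of `Δ^ξ` -/

/-- **`Δ^ξ` is Lipschitz in the imaginary directions on the strip**, uniformly in the mesh: for `0 ≤ κ ≤ r(d)` and `p ∈ Strip d κ`,
`‖Δ^ξ(p) − Δ^ξ(Re p)‖ ≤ (16d∕r(d))·Σ_μ|Im p_μ|` (Cauchy's estimate on the coordinate discs of the fat region, `imLipschitz_of_fat`, fed with
`differentiableAt_DeltaXi` and `norm_DeltaXi_le`). [folklore] -/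
theorem norm_DeltaXi_sub_re_le (n : ℕ) [NeZero n] {κ : ℝ} (hκ0 : 0 ≤ κ) (hκr : κ ≤ rOf d) {p : Fin d → ℂ}
    (hp : p ∈ Strip d κ) :
    ‖DeltaXi n 0 p - DeltaXi n 0 (ofRealVec (reVec p))‖ ≤ (16 * d) / rOf d * ∑ μ, |(p μ).im| := by
  have hn : 1 ≤ n := Nat.one_le_iff_ne_zero.mpr (NeZero.ne n)
  refine imLipschitz_of_fat (DeltaXi n 0) (rOf_pos d) hκ0 hκr ?_ ?_ p hp
  · intro q _ μ
    have h1 : DifferentiableAt ℂ (fun P : Fin d → ℂ => DeltaXi n 0 P) (Function.update q μ (q μ)) :=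
      differentiableAt_DeltaXi n 0 _
    exact h1.comp (q μ) (differentiableAt_update q μ (q μ))
  · intro q hq
    have h := norm_DeltaXi_le n hn 0 le_rfl (rOf_le d) hq
    simpa using h

/-! ## §2. The numerator `aX = E − Δ^ξ` is zero-free on a thin strip -/

/-- on the real zone `E − Δ^ξ = a·(U₀ + Σ_{k≠0} U_k·Δ^ξ∕Δ^ξ(·+2πk)) ≥ a·(4∕π²)^d` (`Ur_zero_ge`; the other terms are `≥ 0`). [folklore] -/
theorem Er_sub_DeltaXir_ge (n : ℕ) [NeZero n] {a : ℝ} (ha : 0 ≤ a) (s : Fin d → ℝ) (hs : ∀ μ, |s μ| ≤ Real.pi) :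
    a * (4 / Real.pi ^ 2) ^ d ≤ Er n a 0 s - DeltaXir n 0 s := by
  have hn : 1 ≤ n := Nat.one_le_iff_ne_zero.mpr (NeZero.ne n)
  have h2 := Ur_zero_ge n hn s hs
  have h3 : 0 ≤ ∑ k ∈ (Finset.univ.erase (fun _ => (0 : Fin n))),
      Ur n k s * (DeltaXir n 0 s / DeltaXir n 0 (shiftr n k s)) :=
    Finset.sum_nonneg fun k _ => mul_nonneg (Ur_nonneg n k s)
      (div_nonneg (DeltaXir_nonneg n 0 le_rfl s) (DeltaXir_nonneg n 0 le_rfl _))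
  have he : Er n a 0 s - DeltaXir n 0 s = a * Ur n (fun _ => (0 : Fin n)) s
      + a * ∑ k ∈ (Finset.univ.erase (fun _ => (0 : Fin n))), Ur n k s * (DeltaXir n 0 s / DeltaXir n 0 (shiftr n k s)) := by
    unfold Er; ring
  rw [he]
  nlinarith [mul_le_mul_of_nonneg_left h2 ha, mul_nonneg ha h3]

/-- **THE NUMERATOR IS ZERO-FREE ON A THIN STRIP, UNIFORMLY IN THE MESH**: for `0 < κ ≤ r(d)` with
`(Λ(d,a) + 16d∕r(d))·d·κ ≤ a(4∕π²)^d∕2` one has `a(4∕π²)^d∕2 ≤ ‖E(p) − Δ^ξ(p)‖` on `Strip d κ`, for EVERY block side `n ≥ 1`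
(`B4Strip.strip_lower_bound`: real positivity §2 + the imaginary-direction Lipschitz bounds of `E` (`uniformImLipschitz_holds`) and of `Δ^ξ` (§1)).
[folklore] -/
theorem norm_E_sub_DeltaXi_ge (n : ℕ) [NeZero n] {a κ : ℝ} (ha : 0 < a) (hκ0 : 0 < κ) (hκr : κ ≤ rOf d)
    (hsmall : (LambdaOf d a a 0 + 16 * d / rOf d) * (d * κ) ≤ a * (4 / Real.pi ^ 2) ^ d / 2) :
    ∀ p ∈ Strip d κ, a * (4 / Real.pi ^ 2) ^ d / 2 ≤ ‖E n a 0 p - DeltaXi n 0 p‖ := by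
  obtain ⟨_, hΛ0, hlipE⟩ := uniformImLipschitz_holds d a a 0
  have hE : ImLipschitz d n a 0 κ (LambdaOf d a a 0) := hlipE n a 0 κ le_rfl le_rfl le_rfl le_rfl hκ0 hκr
  have hΛ : 0 ≤ LambdaOf d a a 0 + 16 * d / rOf d := by
    have := rOf_pos d; positivity
  refine strip_lower_bound (fun p => E n a 0 p - DeltaXi n 0 p) _ _ κ ?_ ?_ hΛ hsmall
  · intro s hs
    have h := Er_sub_DeltaXir_ge n ha.le s hs
    rw [E_ofReal, DeltaXi_ofReal, ← Complex.ofReal_sub, Complex.norm_real, Real.norm_eq_abs]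
    have : a * (4 / Real.pi ^ 2) ^ d ≤ |Er n a 0 s - DeltaXir n 0 s| := h.trans (le_abs_self _)
    linarith
  · intro p hp
    have h1 := hE p hp
    have h2 := norm_DeltaXi_sub_re_le n hκ0.le hκr hp
    calc ‖E n a 0 p - DeltaXi n 0 p - (E n a 0 (ofRealVec (reVec p)) - DeltaXi n 0 (ofRealVec (reVec p)))‖
        = ‖(E n a 0 p - E n a 0 (ofRealVec (reVec p))) - (DeltaXi n 0 p - DeltaXi n 0 (ofRealVec (reVec p)))‖ := by
          ring_nf
      _ ≤ ‖E n a 0 p - E n a 0 (ofRealVec (reVec p))‖ + ‖DeltaXi n 0 p - DeltaXi n 0 (ofRealVec (reVec p))‖ :=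
          norm_sub_le _ _
      _ ≤ LambdaOf d a a 0 * ∑ μ, |(p μ).im| + (16 * d) / rOf d * ∑ μ, |(p μ).im| := add_le_add h1 h2
      _ = (LambdaOf d a a 0 + 16 * d / rOf d) * ∑ μ, |(p μ).im| := by ring

/-! ## §3. The multiplier `symbQGQ`: algebra, side periodicity, holomorphy, lower bound -/

/-- **`symbQGQ = (E − Δ^ξ)∕(aE)`** (`Σ_kU_kR_k = (E − Δ^ξ)∕a` by `E_eq_sum_R`). [folklore] -/
theorem symbQGQ_eq_div (N : ℕ) [NeZero N] {a : ℝ} (ha : a ≠ 0) (P : Fin d → ℂ) :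
    symbQGQ N a P = (E N a 0 P - DeltaXi N 0 P) / (a * E N a 0 P) := by
  have ha' : (a : ℂ) ≠ 0 := Complex.ofReal_ne_zero.mpr ha
  have hX : ∑ k : Fin d → Fin N, B4Strip.U N k P * R N 0 k P = (E N a 0 P - DeltaXi N 0 P) / a := by
    rw [E_eq_sum_R N a 0 P, eq_div_iff ha']
    ring
  unfold symbQGQ
  rw [← Finset.sum_div, hX, div_div]

/-- **`symbQGQ = (B − 1)∕(aB)`** where `Δ^ξ ≠ 0` (`E = Δ^ξ·B`, `B = Bfac`). [folklore] -/
theorem symbQGQ_eq_Bfac (N : ℕ) [NeZero N] {a : ℝ} (ha : a ≠ 0) {P : Fin d → ℂ} (hP : DeltaXi N 0 P ≠ 0) :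
    symbQGQ N a P = (Bfac N a 0 P - 1) / (a * Bfac N a 0 P) := by
  rw [symbQGQ_eq_div N ha, E_eq_DeltaXi_mul_Bfac N a 0 P hP]
  have : DeltaXi N 0 P * Bfac N a 0 P - DeltaXi N 0 P = DeltaXi N 0 P * (Bfac N a 0 P - 1) := by ring
  rw [this, mul_left_comm, mul_div_mul_left _ _ hP]

/-- **SIDE PERIODICITY**: at the strip points with `Re p_μ = −π` (`κ ≤ 1`, `dκ² ≤ 1∕16`), `symbQGQ(p + 2πe_μ) = symbQGQ(p)` — through
`(B − 1)∕(aB)` and `Bfac_tr`; the four side conditions (`p_μ ≠ 0`, `p_μ + 2π ≠ 0`, `Re Δ^ξ > 0` at `p` and at `p + 2πe_μ`) hold there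
(`re_DeltaXi_pos_of_edge`). [folklore] -/
theorem symbQGQ_periodic_side (N : ℕ) [NeZero N] {a : ℝ} (ha : a ≠ 0) {κ : ℝ} (hκ1 : κ ≤ 1)
    (hdκ : (d : ℝ) * κ ^ 2 ≤ 1 / 16) {p : Fin d → ℂ} (hp : p ∈ Strip d κ) (μ : Fin d)
    (hre : (p μ).re = -Real.pi) : symbQGQ N a (tr p μ) = symbQGQ N a p := by
  have hπ := Real.pi_pos
  have hz : p μ ≠ 0 := by
    intro h; rw [h, Complex.zero_re] at hre; linarith
  have hz' : p μ + 2 * Real.pi ≠ 0 := by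
    intro h
    have := congrArg Complex.re h
    rw [← tr_apply_self, tr_re_self, hre, Complex.zero_re] at this
    linarith
  have h0 : DeltaXi N 0 p ≠ 0 := by
    intro h
    have := re_DeltaXi_pos_of_edge N 0 le_rfl hκ1 hdκ (fun ν => (hp ν).2) μ
      (by rw [hre, abs_neg, abs_of_pos hπ])
    rw [h, Complex.zero_re] at this
    linarith
  have h1 : DeltaXi N 0 (tr p μ) ≠ 0 := by
    intro h
    have := re_DeltaXi_pos_of_edge N 0 le_rfl hκ1 hdκ (q := tr p μ)
      (fun ν => by rw [tr_im]; exact (hp ν).2) μ (by rw [tr_re_self, hre]; ring_nf; exact abs_of_pos hπ)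
    rw [h, Complex.zero_re] at this
    linarith
  rw [symbQGQ_eq_Bfac N ha h1, symbQGQ_eq_Bfac N ha h0, Bfac_tr N a 0 p μ hz hz']

/-- **JOINT HOLOMORPHY**: `symbQGQ = Σ_kU_kR_k∕E` is holomorphic at every point of the fat region `F_r` (`r ≤ 1∕4`, `dr² ≤ 1∕16`) where
`E ≠ 0` (`differentiableAt_U`, `differentiableAt_R`, `differentiableAt_E`). [folklore] -/
theorem differentiableAt_symbQGQ (N : ℕ) [NeZero N] (a : ℝ) {r : ℝ} (hr : r ≤ 1 / 4) (hdr : (d : ℝ) * r ^ 2 ≤ 1 / 16)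
    {q : Fin d → ℂ} (hq : q ∈ Fat d r) (hE : E N a 0 q ≠ 0) :
    DifferentiableAt ℂ (symbQGQ N a) q := by
  have h : (symbQGQ N a : (Fin d → ℂ) → ℂ) = fun P => ∑ k : Fin d → Fin N, B4Strip.U N k P * R N 0 k P / E N a 0 P := by
    funext P; rfl
  rw [h]
  refine DifferentiableAt.fun_sum fun k _ => ?_
  exact dAt_div ((differentiableAt_U N hr hq k).mul (differentiableAt_R N 0 le_rfl hr hdr hq k))
    (differentiableAt_E N a 0 le_rfl hr hdr hq) hE

/-- **LOWER BOUND ON THE THIN STRIP**: if `cE ≤ ‖E‖` (`cE > 0`) and `a(4∕π²)^d∕2 ≤ ‖E − Δ^ξ‖` on `Strip d κ` (`κ ≤ r(d)`), then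
`(4∕π²)^d∕(2·M_E) ≤ ‖symbQGQ‖` there, `M_E = boundM d |a| 0` (`norm_E_le` on the fat region). [folklore] -/
theorem norm_symbQGQ_ge (N : ℕ) [NeZero N] {a κ cE : ℝ} (ha : 0 < a) (hκr : κ ≤ rOf d) (hcE : 0 < cE)
    (hE : ∀ p ∈ Strip d κ, cE ≤ ‖E N a 0 p‖)
    (hX : ∀ p ∈ Strip d κ, a * (4 / Real.pi ^ 2) ^ d / 2 ≤ ‖E N a 0 p - DeltaXi N 0 p‖) :
    ∀ p ∈ Strip d κ, (4 / Real.pi ^ 2) ^ d / (2 * boundM d |a| 0) ≤ ‖symbQGQ N a p‖ := by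
  intro p hp
  have hfat : p ∈ Fat d (rOf d) := strip_subset_fat (rOf_pos d).le hκr hp
  have hEle : ‖E N a 0 p‖ ≤ boundM d |a| 0 := norm_E_le N a 0 0 le_rfl le_rfl (rOf_le d) (d_mul_rOf_sq_le d) hfat
  have hEpos : 0 < ‖E N a 0 p‖ := hcE.trans_le (hE p hp)
  have hM : 0 < boundM d |a| 0 := hEpos.trans_le hEle
  have ha' : 0 < |a| := abs_pos.mpr ha.ne'
  rw [symbQGQ_eq_div N ha.ne' p, norm_div, norm_mul, Complex.norm_real, Real.norm_eq_abs]
  rw [div_le_div_iff₀ (by positivity) (by positivity)]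
  have h1 : |a| * (4 / Real.pi ^ 2) ^ d / 2 ≤ ‖E N a 0 p - DeltaXi N 0 p‖ := by
    rw [abs_of_pos ha]; exact hX p hp
  calc (4 / Real.pi ^ 2) ^ d * (|a| * ‖E N a 0 p‖) = (|a| * (4 / Real.pi ^ 2) ^ d / 2) * (2 * ‖E N a 0 p‖) := by ring
    _ ≤ ‖E N a 0 p - DeltaXi N 0 p‖ * (2 * boundM d |a| 0) :=
        mul_le_mul h1 (by linarith) (by positivity) (norm_nonneg _)

/-! ## §4. Strip regularity of `1∕symbQGQ` and of the one-shot multiplier -/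

/-- **`1∕symbQGQ` IS STRIP-REGULAR** on `Strip (d+1) κ` (`0 < κ ≤ r(d+1)`) given the two lower bounds (`cE ≤ ‖E‖`,
`a(4∕π²)^{d+1}∕2 ≤ ‖E − Δ^ξ‖` there), with bound `((4∕π²)^{d+1}∕(2M_E))⁻¹`, for EVERY block side `N`
(`B4ContourShift.stripRegular_inv`). [folklore] -/
theorem stripRegular_symbQGQ_inv (N : ℕ) [NeZero N] {a κ cE : ℝ} (ha : 0 < a) (hκ0 : 0 < κ) (hκr : κ ≤ rOf (d + 1))
    (hcE : 0 < cE) (hE : ∀ p ∈ Strip (d + 1) κ, cE ≤ ‖E N a 0 p‖)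
    (hX : ∀ p ∈ Strip (d + 1) κ, a * (4 / Real.pi ^ 2) ^ (d + 1) / 2 ≤ ‖E N a 0 p - DeltaXi N 0 p‖) :
    StripRegular (d := d) (fun P => (symbQGQ N a P)⁻¹) κ ((4 / Real.pi ^ 2) ^ (d + 1) / (2 * boundM (d + 1) |a| 0))⁻¹ := by
  obtain ⟨hκ1, hdκ⟩ := kappa_small hκ0.le hκr
  have hfat : Strip (d + 1) κ ⊆ Fat (d + 1) (rOf (d + 1)) := strip_subset_fat (rOf_pos _).le hκr
  have hne : ∀ p ∈ Strip (d + 1) κ, E N a 0 p ≠ 0 := by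
    intro p hp h
    have := hE p hp
    rw [h, norm_zero] at this
    linarith
  have hdiffAt : ∀ p ∈ Strip (d + 1) κ, DifferentiableAt ℂ (symbQGQ N a) p := fun p hp =>
    differentiableAt_symbQGQ N a (rOf_le _) (d_mul_rOf_sq_le _) (hfat hp) (hne p hp)
  have hlow := norm_symbQGQ_ge N ha hκr hcE hE hX
  have hc : 0 < (4 / Real.pi ^ 2) ^ (d + 1) / (2 * boundM (d + 1) |a| 0) := by
    obtain ⟨p, hp⟩ : (Strip (d + 1) κ).Nonempty :=
      ⟨fun _ => 0, fun _ => ⟨by simp [Real.pi_pos.le], by simp [hκ0.le]⟩⟩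
    have hEpos : 0 < ‖E N a 0 p‖ := hcE.trans_le (hE p hp)
    have hM : 0 < boundM (d + 1) |a| 0 :=
      hEpos.trans_le (norm_E_le N a 0 0 le_rfl le_rfl (rOf_le _) (d_mul_rOf_sq_le _) (hfat hp))
    positivity
  refine stripRegular_inv hκ0.le hc ?_ ?_ ?_ hlow
  · exact fun p hp => (hdiffAt p hp).continuousAt.continuousWithinAt
  · intro i q hq z hz
    have hP : i.insertNth z (ofRealVec q) ∈ Strip (d + 1) κ :=
      insertNth_mem_Strip hκ0.le i hq (openRect_subset_closedRect κ hz)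
    exact ((hdiffAt _ hP).comp z (differentiableAt_insertNth i _ z)).differentiableWithinAt
  · intro i q hq y hy
    obtain ⟨hP, hre⟩ := insertNth_left_mem hκ0.le i hq hy
    rw [← tr_insertNth_left]
    exact (symbQGQ_periodic_side N ha.ne' hκ1 hdκ hP i hre).symm

/-- **THE ONE-SHOT MULTIPLIER IS STRIP-REGULAR, EVERY BLOCK SIDE AND OFFSET**: given the two strip lower bounds,
`P ↦ G_{N,a,0,τ}(P) ∕ symbQGQ_{N,a}(P)` is `StripRegular κ (boundG(d+1, cE, 0)·((4∕π²)^{d+1}∕(2M_E))⁻¹)` on `Strip (d+1) κ`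
(`B4StripSums.stripRegular_G` × §4's `stripRegular_symbQGQ_inv`). [folklore] -/
theorem stripRegular_oneShot_of (N : ℕ) [NeZero N] {a κ cE : ℝ} (ha : 0 < a) (hκ0 : 0 < κ) (hκr : κ ≤ rOf (d + 1))
    (hcE : 0 < cE) (hE : ∀ p ∈ Strip (d + 1) κ, cE ≤ ‖E N a 0 p‖)
    (hX : ∀ p ∈ Strip (d + 1) κ, a * (4 / Real.pi ^ 2) ^ (d + 1) / 2 ≤ ‖E N a 0 p - DeltaXi N 0 p‖)
    (τ : Fin (d + 1) → Fin N) :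
    StripRegular (d := d) (fun P => G N a 0 τ P / symbQGQ N a P) κ
      (boundG (d + 1) cE 0 * ((4 / Real.pi ^ 2) ^ (d + 1) / (2 * boundM (d + 1) |a| 0))⁻¹) := by
  have h1 := stripRegular_G N a 0 0 le_rfl le_rfl τ hκ0.le hκr hcE hE
  have h2 := stripRegular_symbQGQ_inv N ha hκ0 hκr hcE hE hX
  have h := h1.mul h2 (boundG_nonneg _ hcE le_rfl)
  have hfun : (fun P => G N a 0 τ P / symbQGQ N a P) = fun P => G N a 0 τ P * (symbQGQ N a P)⁻¹ :=
    funext fun P => div_eq_mul_inv _ _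
  rw [hfun]
  exact h

/-- **ASSEMBLY — (CT-1) QUALITATIVE, UNIFORM IN THE MESH**: for every `d` and `a > 0` there are `κ > 0` and `C > 0` (closed forms of the
B4 strip column's `rOf ∕ LambdaOf ∕ boundM ∕ boundG`, depending on `d, a` ONLY) such that for EVERY block side `n + 1` and EVERY offset `τ`
the one-shot multiplier `P ↦ G_{n+1,a,0,τ}(P) ∕ symbQGQ_{n+1,a}(P)` is `StripRegular κ C` on `Strip (d+1) κ`. [folklore] -/
theorem exists_stripRegular_oneShot (d : ℕ) {a : ℝ} (ha : 0 < a) :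
    ∃ κ C : ℝ, 0 < κ ∧ 0 < C ∧ ∀ (n : ℕ) (τ : Fin (d + 1) → Fin (n + 1)),
      StripRegular (d := d) (fun P => G (n + 1) a 0 τ P / symbQGQ (n + 1) a P) κ C := by
  -- the zero-free strip of `E` (B4 p. 586, the tree's `uniformStrip_explicit`) at the one-point windows `a₋ = a₊ = a`, `m²₊ = 0`
  obtain ⟨hκE, hE⟩ := uniformStrip_explicit (d + 1) a a 0 ha
  set κE : ℝ := min (rOf (d + 1)) (a * (4 / Real.pi ^ 2) ^ (d + 1) / 2 / (LambdaOf (d + 1) a a 0 * ↑(d + 1) + 1)) with hκEdef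
  set cE : ℝ := a * (4 / Real.pi ^ 2) ^ (d + 1) / 2 with hcEdef
  -- the zero-free strip of the numerator `aX = E − Δ^ξ` (§2)
  set Λ : ℝ := LambdaOf (d + 1) a a 0 + 16 * ↑(d + 1) / rOf (d + 1) with hΛdef
  set κX : ℝ := min (rOf (d + 1)) (cE / (Λ * ↑(d + 1) + 1)) with hκXdef
  have hcE : 0 < cE := by positivity
  have hΛ : 0 ≤ Λ := by
    obtain ⟨_, hΛ0, _⟩ := uniformImLipschitz_holds (d + 1) a a 0
    have := rOf_pos (d + 1)
    positivity
  have hκX : 0 < κX := lt_min (rOf_pos _) (by positivity)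
  set κ : ℝ := min κE κX with hκdef
  have hκ0 : 0 < κ := lt_min hκE hκX
  have hκr : κ ≤ rOf (d + 1) := (min_le_right _ _).trans (min_le_left _ _)
  have hκκE : κ ≤ κE := min_le_left _ _
  have hκκX : κ ≤ κX := min_le_right _ _
  -- the smallness condition of §2 at `κ`
  have hsmall : Λ * (↑(d + 1) * κ) ≤ cE := by
    have hk : κ ≤ cE / (Λ * ↑(d + 1) + 1) := hκκX.trans (min_le_right _ _)
    have hden : 0 < Λ * ↑(d + 1) + 1 := by positivity
    have hd0 : (0 : ℝ) ≤ ↑(d + 1) := by positivity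
    calc Λ * (↑(d + 1) * κ) = (Λ * ↑(d + 1)) * κ := by ring
      _ ≤ (Λ * ↑(d + 1)) * (cE / (Λ * ↑(d + 1) + 1)) := mul_le_mul_of_nonneg_left hk (by positivity)
      _ ≤ (Λ * ↑(d + 1) + 1) * (cE / (Λ * ↑(d + 1) + 1)) :=
          mul_le_mul_of_nonneg_right (by linarith) (by positivity)
      _ = cE := mul_div_cancel₀ _ hden.ne'
  refine ⟨κ, max (boundG (d + 1) cE 0 * ((4 / Real.pi ^ 2) ^ (d + 1) / (2 * boundM (d + 1) |a| 0))⁻¹) 1, hκ0,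
    lt_max_of_lt_right one_pos, fun n τ => ?_⟩
  refine (stripRegular_oneShot_of (d := d) (n + 1) ha hκ0 hκr hcE ?_ ?_ τ).mono (le_max_left _ _)
  · exact fun p hp => hE (n + 1) a 0 le_rfl le_rfl le_rfl le_rfl p (strip_mono hκκE hp)
  · exact fun p hp => norm_E_sub_DeltaXi_ge (n + 1) ha hκ0 hκr (by simpa [hΛdef] using hsmall) p hp

/-! ## §5. The mesh-free entry bound of the one-shot section on `ℤ^{d+1}` -/

/-- **THE MESH-FREE ENTRY BOUND, CHART FORM**: for every `d` and `a > 0` there are `κ > 0`, `C > 0` (depending on `d, a` only) with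
`|H(chart n x τ, y)| ≤ C·e^{−κ|x − y|_∞}` for EVERY mesh `n`, block `x`, offset `τ`, coarse site `y` — NO factor `(n+1)^{(d+1)∕2}`
(the OWNER's (41) `kerH_chart_eq_latticeKernel` + `B4ContourShift.latticeKernel_decay` on §4's strip-regular multiplier). [folklore] -/
theorem exists_kerH_decay_chart (d : ℕ) {a : ℝ} (ha : 0 < a) :
    ∃ κ C : ℝ, 0 < κ ∧ 0 < C ∧ ∀ (n : ℕ) (x y : X (d + 1)) (τ : Fin (d + 1) → Fin (n + 1)),
      |kerH n a (chart n x τ) y| ≤ C * Real.exp (-(κ * supNorm (x - y))) := by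
  obtain ⟨κ, C, hκ, hC, h⟩ := exists_stripRegular_oneShot d ha
  refine ⟨κ, C, hκ, hC, fun n x y τ => ?_⟩
  have h1 := latticeKernel_decay (h n τ) hκ.le (x - y)
  rw [← kerH_chart_eq_latticeKernel n ha x y τ, Complex.norm_real, Real.norm_eq_abs] at h1
  exact h1

/-- **THE MESH-FREE ENTRY BOUND**: `|H(z, y)| ≤ C·e^{−κ|blk z − y|_∞}` for EVERY fine site `z` (every fine site is a chart point,
`chart_blk_locFin`), every coarse site `y`, every mesh `n` (the sup-DISTANCE form follows with the tree's `B6Hprime2101.dist_le_supNorm`,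
not imported here). [folklore] -/
theorem exists_kerH_decay (d : ℕ) {a : ℝ} (ha : 0 < a) :
    ∃ κ C : ℝ, 0 < κ ∧ 0 < C ∧ ∀ (n : ℕ) (z y : X (d + 1)),
      |kerH n a z y| ≤ C * Real.exp (-(κ * supNorm (blk n z - y))) := by
  obtain ⟨κ, C, hκ, hC, h⟩ := exists_kerH_decay_chart d ha
  refine ⟨κ, C, hκ, hC, fun n z y => ?_⟩
  have h1 := h n (blk n z) y (locFin n z)
  rwa [chart_blk_locFin] at h1

/-! ## §6. The periodised kernel on every torus -/

/-- **TORUS FORM OF (CT-1)'s COROLLARY**: under the hypotheses of `stripRegular_oneShot_of`, the kernel of the one-shot multiplier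
descended to ANY torus `Π_i ℤ∕N_i` (all `N_i ≥ 1`) — the periodisation `Σ_m K(x + Nm)` of the `ℤ^{d+1}` kernel
(`B4TorusKernel.MultiPeriod.torusKernel_descend_eq`) — decays like `C·periodConst κ d·e^{−(κ∕(d+1))|x|_{T,∞}}` in the torus sup metric,
for EVERY block side `N` and offset `τ` (`torusKernel_descend_decay_torusMetric` BY NAME).  The identification of this kernel with the
torus one-shot SECTION is NOT here. [folklore] -/
theorem torusKernel_oneShot_decay (N : ℕ) [NeZero N] {a κ cE : ℝ} (ha : 0 < a) (hκ0 : 0 < κ) (hκr : κ ≤ rOf (d + 1))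
    (hcE : 0 < cE) (hE : ∀ p ∈ Strip (d + 1) κ, cE ≤ ‖E N a 0 p‖)
    (hX : ∀ p ∈ Strip (d + 1) κ, a * (4 / Real.pi ^ 2) ^ (d + 1) / 2 ≤ ‖E N a 0 p - DeltaXi N 0 p‖)
    (τ : Fin (d + 1) → Fin N) {Np : Fin (d + 1) → ℕ} (hNp : ∀ i, 1 ≤ Np i) (x : Fin (d + 1) → ℤ) :
    ‖B4TorusKernel.MultiPeriod.torusKernel
        (B4TorusKernel.descendC _ (stripRegular_oneShot_of N ha hκ0 hκr hcE hE hX τ) hκ0.le) Np x‖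
      ≤ boundG (d + 1) cE 0 * ((4 / Real.pi ^ 2) ^ (d + 1) / (2 * boundM (d + 1) |a| 0))⁻¹
        * B4TorusKernel.periodConst κ d * Real.exp (-(κ / (d + 1) * B4TorusKernel.MultiPeriod.torusSupNorm Np x)) :=
  B4TorusKernel.MultiPeriod.torusKernel_descend_decay_torusMetric _ hκ0 hNp x

end Summit.QuantumFields.BalabanUV.T4Continuum.NE7b.OneShotChartStrip
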